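import Literature.AlgebraicTopology.Homotopy.CubeAbsolutization
import Literature.AlgebraicTopology.Homotopy.RelativeHomotopyGroupStructure
import HarnessLib

/-!
# Lidded relative cubes and their classes in `πₙ(X, A, a)`; the homotopy addition theorem
# for lidded cubes

Topic `Literature/AlgebraicTopology/Homotopy`. For a pair `(X, A)` with base point `a ∈ A`, a
**lidded cell** of dimension `m + 2` is a map `f : Iᵐ⁺² → X` sending the lid `{y₀ = 1}` to `a`
and the whole boundary `∂Iᵐ⁺²` into `A` (`LiddedCube.LidCell A a m`): a map of triples
`(Iᵐ⁺², ∂Iᵐ⁺², {y₀ = 1}) → (X, A, a)`. The relative generalized loops of the tree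
(`RelGenLoop 0 A a`, `RelativeHomotopyGroups.lean`: free face `{y₀ = 0} ↦ A`, the rest of the
boundary `↦ a`) are the lidded cells whose walls `{yⱼ ∈ {0, 1}}`, `j ≥ 1`, go to `a`.

Currying the coordinate `y₀` (as in `RelativeHomotopyGroupStructure.lean`; Miller, *Lectures on
Algebraic Topology* (2020), Lecture 47: `πₙ(X, A, a) ≅ πₙ₋₁(P(X; A, a))`) turns a lidded cell into a
cube `(Iᵐ⁺¹, ∂Iᵐ⁺¹) → (P, P_A)` in the path space `P = P(X; A, a)` (paths from `A` to `a`) whose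
boundary goes into the subspace `P_A` of paths *inside* `A`, which contracts in itself to the
constant path (`LiddedCube.pathContraction`: `γ ↦ γ|[s, 1]` reparametrised). Hence
(`CubeAbsolutization.lean`):

* **`LiddedCube.lidClass f hf ∈ πₘ₊₂(X, A, a)`** — the class of a lidded cell (the class of the
  absolutised curried cube, transported back along the currying isomorphism); it is the ordinary
  class on relative generalized loops (`lidClass_eq_mk`), invariant under homotopies through
  lidded cells (`lidClass_eq_of_homotopy`), and trivial on cells inside `A`
  (`lidClass_eq_one_of_forall_mem`; Hatcher, *Algebraic Topology* (2002), §4.1 p. 343,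
  compression);
* **`LiddedCube.prod_lidClass_cubeFace_zpow_eq_one`** — the **homotopy addition theorem for a
  lidded cube** `g : Iᴹ⁺⁴ → X` (lid `{y₀ = 1} ↦ a`, free face `{y₀ = 0} ↦ A`, and
  `{yᵢ, yⱼ ∈ {0, 1}} ↦ A` for `1 ≤ i < j`; `LiddedCube.IsLidded`): its `2(M + 3)` side faces
  `{yⱼ = ε}`, `j ≥ 1`, are lidded cells and `∏ⱼ ([g ∘ ι_{j+1,1}] · [g ∘ ι_{j+1,0}]⁻¹)^((-1)ʲ) = 1`
  in the abelian group `π_{M+3}(X, A, a)` — the cubical homotopy addition theorem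
  (`CubicalHomotopyAddition.lean`; Hatcher 2002, §4.1 pp. 340–341) applied in `P` to the curried
  cube after absolutising its codimension-two skeleton through `P_A`
  (`CubeAbs.prod_absClass_cubeFace_zpow_eq_one`).

This is the cube-level input of the relative homotopy addition theorem for singular simplices
(Spanier, *Algebraic Topology* (1981), Ch. 7 §5 Prop. 3) in
`Literature/AlgebraicTopology/SingularHomology/`. Everything is proved; `[folklore]`.

## References

* A. Hatcher, *Algebraic Topology*, CUP (2002), §4.1, pp. 340–344. [HatcherAT2002]
* H. Miller, *Lectures on Algebraic Topology*, World Scientific (2020/2022), Lecture 47. [Miller2020]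
* E. H. Spanier, *Algebraic Topology*, Springer (1981), Ch. 7 §5, Prop. 3. [Spanier1981]
-/

noncomputable section

open scoped unitInterval Topology Topology.Homotopy
open Set Function

universe u

namespace Literature.AlgebraicTopology.Homotopy

namespace LiddedCube

open CubeHAT (cubeFace cubeFace_apply IsExtreme isExtreme_zero isExtreme_one)
open RelGenLoop (EndPath EndPath.base)

variable {X : Type u} [TopologicalSpace X] {A : Set X} {a : A}

/-! ### Paths inside `A` and their contraction -/

variable (A a) in
/-- **The subspace `P_A ⊆ P(X; A, a)` of paths running inside `A`.** [folklore] -/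
def inA : Set (EndPath A a) := {γ | ∀ t, (γ : C(I, X)) t ∈ A}

/-- The constant path lies inside `A`. [folklore] -/
lemma base_mem_inA : (EndPath.base : EndPath A a) ∈ inA A a := fun _ => a.2

/-- The point `s + (1 - s) t` of `I` (the affine map of `I` onto `[s, 1]`). [folklore] -/
def shrinkPt (s t : I) : I :=
  ⟨(s : ℝ) + (1 - s) * t, by
    constructor
    · nlinarith [s.2.1, s.2.2, t.2.1]
    · nlinarith [s.2.1, s.2.2, t.2.1, t.2.2]⟩

/-- `shrinkPt` as a real number. [folklore] -/
@[simp] lemma coe_shrinkPt (s t : I) : (shrinkPt s t : ℝ) = s + (1 - s) * t := rfl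

/-- `shrinkPt` is continuous. [folklore] -/
lemma continuous_shrinkPt : Continuous fun p : I × I => shrinkPt p.1 p.2 :=
  Continuous.subtype_mk (by fun_prop) _

/-- `shrinkPt 0 t = t`. [folklore] -/
@[simp] lemma shrinkPt_zero (t : I) : shrinkPt 0 t = t := Subtype.ext (by simp)

/-- `shrinkPt 1 t = 1`. [folklore] -/
@[simp] lemma shrinkPt_one (t : I) : shrinkPt 1 t = 1 := Subtype.ext (by simp)

/-- `shrinkPt s 1 = 1`. [folklore] -/
@[simp] lemma shrinkPt_right_one (s : I) : shrinkPt s 1 = 1 := Subtype.ext (by simp)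

/-- The reparametrisation `((s, γ), t) ↦ γ (s + (1 - s) t)`, jointly continuous. [folklore] -/
def shrinkFun : C((I × inA A a) × I, X) where
  toFun q := (((q.1.2 : inA A a) : EndPath A a) : C(I, X)) (shrinkPt q.1.1 q.2)
  continuous_toFun := by
    have h1 : Continuous fun q : (I × inA A a) × I => (((q.1.2 : inA A a) : EndPath A a) : C(I, X)) := by
      fun_prop
    have h2 : Continuous fun q : (I × inA A a) × I => shrinkPt q.1.1 q.2 :=
      continuous_shrinkPt.comp ((continuous_fst.comp continuous_fst).prodMk continuous_snd)
    exact continuous_eval.comp (h1.prodMk h2)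

/-- The reparametrised path `t ↦ γ (s + (1 - s) t)` of a path inside `A`, again a path from `A`
to `a` inside `A`. [folklore] -/
def shrink (p : I × inA A a) : inA A a :=
  ⟨⟨shrinkFun.curry p, p.2.2 _, by
      show (((p.2 : inA A a) : EndPath A a) : C(I, X)) (shrinkPt p.1 1) = a
      rw [shrinkPt_right_one]; exact ((p.2 : inA A a) : EndPath A a).2.2⟩,
    fun t => p.2.2 _⟩

/-- `shrink` pointwise. [folklore] -/
@[simp] lemma shrink_apply (p : I × inA A a) (t : I) :
    (((shrink p : inA A a) : EndPath A a) : C(I, X)) t =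
      (((p.2 : inA A a) : EndPath A a) : C(I, X)) (shrinkPt p.1 t) :=
  rfl

/-- `shrink` is continuous. [folklore] -/
lemma continuous_shrink : Continuous (shrink : I × inA A a → inA A a) :=
  Continuous.subtype_mk (Continuous.subtype_mk shrinkFun.curry.continuous _) _

/-- **`P_A` contracts in itself to the constant path**, keeping it fixed: `γ ↦ γ|[s, 1]`
reparametrised. [folklore] -/
def pathContraction : CubeAbs.PointedContraction (inA A a) (EndPath.base : EndPath A a) where
  toFun := shrink
  continuous_toFun := continuous_shrink
  mem := base_mem_inA
  apply_zero γ := Subtype.ext (Subtype.ext (ContinuousMap.ext fun t => by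
    rw [shrink_apply, shrinkPt_zero]))
  apply_one γ := Subtype.ext (ContinuousMap.ext fun t => by
    rw [shrink_apply, shrinkPt_one, RelGenLoop.EndPath.coe_base, ContinuousMap.const_apply]
    exact ((γ : inA A a) : EndPath A a).2.2)
  apply_base s := Subtype.ext (ContinuousMap.ext fun t => by
    rw [shrink_apply]; rfl)

/-! ### Lidded cells and their curried cubes -/

variable (A a) in
/-- **Lidded cells** of dimension `m + 2`: maps `f : Iᵐ⁺² → X` with the lid `{y₀ = 1}` sent to
`a` and the boundary `∂Iᵐ⁺²` into `A` (maps of triples `(Iᵐ⁺², ∂Iᵐ⁺², {y₀ = 1}) → (X, A, a)`).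
[folklore] -/
def LidCell (m : ℕ) : Set C((Fin (m + 2) → I), X) :=
  {f | (∀ y : Fin (m + 2) → I, y 0 = 1 → f y = a) ∧ ∀ y ∈ Cube.boundary (Fin (m + 2)), f y ∈ A}

variable {m : ℕ}

/-- Relative generalized loops (free face `{y₀ = 0}`) are lidded cells. [folklore] -/
lemma mem_lidCell_of_mem_relGenLoop {f : C((Fin (m + 2) → I), X)}
    (hf : f ∈ RelGenLoop (0 : Fin (m + 2)) A a) : f ∈ LidCell A a m :=
  ⟨fun y hy => hf.2 y (Or.inl hy),
    fun _ hy => RelGenLoop.apply_mem_of_mem_boundary (⟨f, hf⟩ : RelGenLoop (0 : Fin (m + 2)) A a) hy⟩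

/-- `Fin.cons t y'` lies on `∂Iᵐ⁺²` when `y'` lies on `∂Iᵐ⁺¹`. [folklore] -/
lemma cons_mem_boundary (t : I) {y' : Fin (m + 1) → I} (hy' : y' ∈ Cube.boundary (Fin (m + 1))) :
    (Fin.cons t y' : Fin (m + 2) → I) ∈ Cube.boundary (Fin (m + 2)) := by
  obtain ⟨j, hj⟩ := hy'
  exact ⟨j.succ, by simpa using hj⟩

/-- `Fin.cons 0 y'` and `Fin.cons 1 y'` lie on `∂Iᵐ⁺²`. [folklore] -/
lemma cons_mem_boundary_of_isExtreme {t : I} (ht : IsExtreme t) (y' : Fin (m + 1) → I) :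
    (Fin.cons t y' : Fin (m + 2) → I) ∈ Cube.boundary (Fin (m + 2)) :=
  ⟨0, by rw [Fin.cons_zero]; exact ht⟩

/-- `(y', t) ↦ (t, y')` as a map `Iᵐ⁺¹ × I → Iᵐ⁺²` is continuous. [folklore] -/
lemma continuous_consSwap {n : ℕ} :
    Continuous fun q : (Fin (n + 1) → I) × I => (Fin.cons q.2 q.1 : Fin (n + 2) → I) :=
  continuous_pi fun i => Fin.cases (by simp only [Fin.cons_zero]; fun_prop)
    (fun k => by simp only [Fin.cons_succ]; fun_prop) i

/-- The map `(y', t) ↦ f (t, y')`, jointly continuous. [folklore] -/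
def consFun (f : C((Fin (m + 2) → I), X)) : C((Fin (m + 1) → I) × I, X) where
  toFun q := f (Fin.cons q.2 q.1)
  continuous_toFun := f.continuous.comp continuous_consSwap

/-- **The curried cube** `y' ↦ (t ↦ f (t, y'))` of a lidded cell: a cube `Iᵐ⁺¹ → P(X; A, a)`.
[folklore] -/
def cellCurry (f : C((Fin (m + 2) → I), X)) (hf : f ∈ LidCell A a m) : C((Fin (m + 1) → I), EndPath A a) where
  toFun y' := ⟨(consFun f).curry y',
    ⟨hf.2 (Fin.cons 0 y') (cons_mem_boundary_of_isExtreme isExtreme_zero y'),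
      hf.1 (Fin.cons 1 y') (Fin.cons_zero _ _)⟩⟩
  continuous_toFun := (consFun f).curry.continuous.subtype_mk _

/-- The curried cube pointwise. [folklore] -/
@[simp] lemma cellCurry_apply (f : C((Fin (m + 2) → I), X)) (hf : f ∈ LidCell A a m)
    (y' : Fin (m + 1) → I) (t : I) : ((cellCurry f hf y' : EndPath A a) : C(I, X)) t = f (Fin.cons t y') :=
  rfl

/-- The curried cube sends `∂Iᵐ⁺¹` into `P_A`. [folklore] -/
lemma cellCurry_mem_inA (f : C((Fin (m + 2) → I), X)) (hf : f ∈ LidCell A a m) :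
    ∀ y' ∈ Cube.boundary (Fin (m + 1)), cellCurry f hf y' ∈ inA A a :=
  fun y' hy' t => by rw [cellCurry_apply]; exact hf.2 _ (cons_mem_boundary t hy')

/-! ### Re-indexing `πₘ₊₁` along `Fin (m + 1) ≃ {j : Fin (m + 2) // j ≠ 0}` -/

section Reindex

variable {Y : Type u} [TopologicalSpace Y] {y₀ : Y}

variable (m) in
/-- The index equivalence `Fin (m + 1) ≃ {j : Fin (m + 2) // j ≠ 0}`, `k ↦ k + 1` (Mathlib's
`finSuccAboveEquiv 0`). [folklore] -/
def succEquiv : Fin (m + 1) ≃ { j : Fin (m + 2) // j ≠ 0 } := finSuccAboveEquiv 0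

/-- `succEquiv` is `Fin.succ`. [folklore] -/
@[simp] lemma coe_succEquiv (k : Fin (m + 1)) :
    ((succEquiv m k : { j : Fin (m + 2) // j ≠ 0 }) : Fin (m + 2)) = k.succ := by
  simp [succEquiv, finSuccAboveEquiv_apply]

/-- Re-indexing generalized loops along `succEquiv` (Mathlib's `GenLoop.congr`):
`p ↦ p ∘ (· ∘ succ)`. [folklore] -/
def reindexLoop (p : Ω^ (Fin (m + 1)) Y y₀) : Ω^ { j : Fin (m + 2) // j ≠ 0 } Y y₀ :=
  GenLoop.congr y₀ (succEquiv m) p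

/-- `reindexLoop` pointwise. [folklore] -/
@[simp] lemma reindexLoop_apply (p : Ω^ (Fin (m + 1)) Y y₀) (t : { j : Fin (m + 2) // j ≠ 0 } → I) :
    reindexLoop p t = p (fun k => t (succEquiv m k)) := rfl

/-- Re-indexing commutes with concatenation. [folklore] -/
lemma reindexLoop_transAt (k : Fin (m + 1)) (p q : Ω^ (Fin (m + 1)) Y y₀) :
    reindexLoop (GenLoop.transAt k p q) =
      GenLoop.transAt (succEquiv m k) (reindexLoop p) (reindexLoop q) := by
  apply GenLoop.ext; intro t
  rw [reindexLoop_apply]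
  change (if _ then _ else _) = (if _ then _ else _)
  have hu : ∀ v : I, (fun k' => update t (succEquiv m k) v (succEquiv m k')) =
      update (fun k' => t (succEquiv m k')) k v := fun v =>
    update_comp_eq_of_injective t (succEquiv m).injective k v
  simp only [reindexLoop_apply, hu]

/-- Re-indexing preserves and reflects homotopy rel boundary. [folklore] -/
lemma homotopic_reindexLoop_iff (p q : Ω^ (Fin (m + 1)) Y y₀) :
    GenLoop.Homotopic (reindexLoop p) (reindexLoop q) ↔ GenLoop.Homotopic p q := by
  constructor
  · rintro ⟨H⟩
    refine ⟨{ toFun := fun sy => H (sy.1, fun j => sy.2 ((succEquiv m).symm j))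
              continuous_toFun := by fun_prop
              map_zero_left := fun y => ?_
              map_one_left := fun y => ?_
              prop' := fun s y hy => ?_ }⟩
    · show H (0, _) = _
      rw [H.apply_zero]
      change p (fun k => y ((succEquiv m).symm (succEquiv m k))) = p y
      simp
    · show H (1, _) = _
      rw [H.apply_one]
      change q (fun k => y ((succEquiv m).symm (succEquiv m k))) = q y
      simp
    · obtain ⟨k, hk⟩ := hy
      have hb : (fun j => y ((succEquiv m).symm j)) ∈ Cube.boundary { j : Fin (m + 2) // j ≠ 0 } :=
        ⟨succEquiv m k, by simpa using hk⟩
      have h1 := H.prop' s _ hb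
      change H (s, _) = p (fun k => y ((succEquiv m).symm (succEquiv m k))) at h1
      show H (s, _) = p y
      simpa using h1
  · rintro ⟨H⟩
    refine ⟨{ toFun := fun sy => H (sy.1, fun k => sy.2 (succEquiv m k))
              continuous_toFun := by fun_prop
              map_zero_left := fun y => by show H (0, _) = _; rw [H.apply_zero]; rfl
              map_one_left := fun y => by show H (1, _) = _; rw [H.apply_one]; rfl
              prop' := fun s y hy => ?_ }⟩
    obtain ⟨j, hj⟩ := hy
    have hb : (fun k => y (succEquiv m k)) ∈ Cube.boundary (Fin (m + 1)) :=
      ⟨(succEquiv m).symm j, by simpa using hj⟩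
    exact H.prop' s _ hb

/-- **Re-indexing `πₘ₊₁(Y, y₀)` along `succEquiv`**, a group isomorphism. (The underlying
equivalence is the `homotopyGroupCongr` of `HomologyWeakEquivalence.lean`, not imported here.)
[folklore] -/
def reindex : HomotopyGroup (Fin (m + 1)) Y y₀ ≃* HomotopyGroup { j : Fin (m + 2) // j ≠ 0 } Y y₀ where
  toEquiv := Quotient.congr (GenLoop.congr y₀ (succEquiv m)).toEquiv fun p q =>
    (homotopic_reindexLoop_iff p q).symm
  map_mul' := Quotient.ind₂ fun p q => by
    refine (congrArg _ (HomotopyGroup.mul_spec (i := (0 : Fin (m + 1))) (p := p) (q := q))).trans ?_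
    refine Eq.trans ?_ (HomotopyGroup.mul_spec (i := succEquiv m 0) (p := reindexLoop p)
      (q := reindexLoop q)).symm
    show (⟦reindexLoop (GenLoop.transAt 0 q p)⟧ : HomotopyGroup { j : Fin (m + 2) // j ≠ 0 } Y y₀) = _
    rw [reindexLoop_transAt]

/-- `reindex` on a class. [folklore] -/
@[simp] lemma reindex_mk (p : Ω^ (Fin (m + 1)) Y y₀) :
    reindex (⟦p⟧ : HomotopyGroup (Fin (m + 1)) Y y₀) = ⟦reindexLoop p⟧ := rfl

end Reindex

/-! ### The class of a lidded cell -/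

/-- From classes of cubes in the path space to `πₘ₊₂(X, A, a)`: re-index and uncurry
(`relHomotopyGroupMulEquiv`, `RelativeHomotopyGroupStructure.lean`), a group homomorphism.
[folklore] -/
def toRel : HomotopyGroup (Fin (m + 1)) (EndPath A a) EndPath.base →* RelHomotopyGroup.Pi (m + 2) X A a :=
  ((relHomotopyGroupMulEquiv (i := (0 : Fin (m + 2))) (X := X) (A := A) (a := a)).symm.toMonoidHom).comp
    reindex.toMonoidHom

/-- `toRel` on a class: the class of the uncurried re-indexed loop. [folklore] -/
lemma toRel_mk (w : Ω^ (Fin (m + 1)) (EndPath A a) EndPath.base) :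
    toRel (⟦w⟧ : HomotopyGroup (Fin (m + 1)) (EndPath A a) EndPath.base) =
      (⟦RelGenLoop.uncurry 0 (reindexLoop w)⟧ : RelHomotopyGroup.Pi (m + 2) X A a) := rfl

/-- The uncurried re-indexed loop pointwise: `y ↦ (w (tail y)) (y 0)`. [folklore] -/
lemma uncurry_reindexLoop_apply (w : Ω^ (Fin (m + 1)) (EndPath A a) EndPath.base)
    (y : Fin (m + 2) → I) :
    RelGenLoop.uncurry 0 (reindexLoop w) y = ((w (Fin.tail y) : EndPath A a) : C(I, X)) (y 0) := by
  rw [RelGenLoop.uncurry_apply, reindexLoop_apply]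
  rfl

/-- **The class `[f] ∈ πₘ₊₂(X, A, a)` of a lidded cell**: the class of its curried cube
`(Iᵐ⁺¹, ∂Iᵐ⁺¹) → (P, P_A)`, absolutised through the contraction of `P_A` (`CubeAbs.absClass`) and
transported back to `πₘ₊₂(X, A, a)`. [folklore] -/
def lidClass (f : C((Fin (m + 2) → I), X)) (hf : f ∈ LidCell A a m) : RelHomotopyGroup.Pi (m + 2) X A a :=
  toRel (CubeAbs.absClass pathContraction (cellCurry f hf) (cellCurry_mem_inA f hf))

/-- **On relative generalized loops the class is the ordinary class.** [folklore] -/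
theorem lidClass_eq_mk (p : RelGenLoop (0 : Fin (m + 2)) A a) :
    lidClass (p : C((Fin (m + 2) → I), X)) (mem_lidCell_of_mem_relGenLoop p.2) =
      (⟦p⟧ : RelHomotopyGroup.Pi (m + 2) X A a) := by
  -- the curried cube of a relative loop is a generalized loop at the constant path
  have hb : ∀ y' ∈ Cube.boundary (Fin (m + 1)), cellCurry (p : C((Fin (m + 2) → I), X))
      (mem_lidCell_of_mem_relGenLoop p.2) y' = EndPath.base := by
    intro y' hy'
    apply Subtype.ext; apply ContinuousMap.ext; intro t
    rw [cellCurry_apply, RelGenLoop.EndPath.coe_base, ContinuousMap.const_apply]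
    refine p.2.2 _ (Or.inr ?_)
    obtain ⟨j, hj⟩ := hy'
    exact ⟨j.succ, Fin.succ_ne_zero j, by simpa using hj⟩
  let w : Ω^ (Fin (m + 1)) (EndPath A a) EndPath.base :=
    ⟨cellCurry (p : C((Fin (m + 2) → I), X)) (mem_lidCell_of_mem_relGenLoop p.2), hb⟩
  show toRel (CubeAbs.absClass pathContraction w.1
    (cellCurry_mem_inA (p : C((Fin (m + 2) → I), X)) (mem_lidCell_of_mem_relGenLoop p.2))) = _
  rw [CubeAbs.absClass_genLoop, toRel_mk]
  refine congrArg (Quotient.mk _) (RelGenLoop.ext _ _ fun y => ?_)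
  rw [uncurry_reindexLoop_apply]
  change p (Fin.cons (y 0) (Fin.tail y)) = p y
  rw [Fin.cons_self_tail]

/-- The map `((s, y'), t) ↦ H (s, (t, y'))` of a homotopy, jointly continuous. [folklore] -/
def consHtpyFun (H : C(I × (Fin (m + 2) → I), X)) : C((I × (Fin (m + 1) → I)) × I, X) where
  toFun q := H (q.1.1, Fin.cons q.2 q.1.2)
  continuous_toFun := H.continuous.comp ((continuous_fst.comp continuous_fst).prodMk
    (continuous_consSwap.comp ((continuous_snd.comp continuous_fst).prodMk continuous_snd)))

/-- **Invariance under homotopies through lidded cells.** [folklore] -/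
theorem lidClass_eq_of_homotopy {f f' : C((Fin (m + 2) → I), X)} (hf : f ∈ LidCell A a m)
    (hf' : f' ∈ LidCell A a m) (H : C(I × (Fin (m + 2) → I), X)) (hH0 : ∀ y, H (0, y) = f y)
    (hH1 : ∀ y, H (1, y) = f' y) (hH : ∀ s : I, H.curry s ∈ LidCell A a m) :
    lidClass f hf = lidClass f' hf' := by
  -- curry the homotopy into a homotopy of maps of pairs `(Iᵐ⁺¹, ∂Iᵐ⁺¹) → (P, P_A)`
  let K : C(I × (Fin (m + 1) → I), EndPath A a) :=
    ⟨fun sy => ⟨(consHtpyFun H).curry sy,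
        ⟨show H (sy.1, Fin.cons 0 sy.2) ∈ A from
            (hH sy.1).2 (Fin.cons 0 sy.2) (cons_mem_boundary_of_isExtreme isExtreme_zero sy.2),
          show H (sy.1, Fin.cons 1 sy.2) = a from (hH sy.1).1 (Fin.cons 1 sy.2) (Fin.cons_zero _ _)⟩⟩,
      ((consHtpyFun H).curry.continuous).subtype_mk _⟩
  have hK0 : ∀ y', K (0, y') = cellCurry f hf y' := fun y' =>
    Subtype.ext (ContinuousMap.ext fun t => show H (0, Fin.cons t y') = f (Fin.cons t y') from hH0 _)
  have hK1 : ∀ y', K (1, y') = cellCurry f' hf' y' := fun y' =>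
    Subtype.ext (ContinuousMap.ext fun t => show H (1, Fin.cons t y') = f' (Fin.cons t y') from hH1 _)
  have hKB : ∀ (s : I), ∀ y' ∈ Cube.boundary (Fin (m + 1)), K (s, y') ∈ inA A a :=
    fun s y' hy' t => show H (s, Fin.cons t y') ∈ A from (hH s).2 _ (cons_mem_boundary t hy')
  have key : CubeAbs.absClass pathContraction (cellCurry f hf) (cellCurry_mem_inA f hf) =
      CubeAbs.absClass pathContraction (cellCurry f' hf') (cellCurry_mem_inA f' hf') :=
    CubeAbs.absClass_eq_of_pairHomotopy pathContraction _ _ K hK0 hK1 hKB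
  exact congrArg toRel key

/-- Lidded cells with the same values have the same class. [folklore] -/
theorem lidClass_congr {f f' : C((Fin (m + 2) → I), X)} (hf : f ∈ LidCell A a m)
    (hf' : f' ∈ LidCell A a m) (h : ∀ y, f y = f' y) : lidClass f hf = lidClass f' hf' := by
  have : f = f' := ContinuousMap.ext h
  subst this
  rfl

/-- **Compression**: a lidded cell inside `A` has trivial class. [cite: HatcherAT2002, §4.1 p. 343] -/
theorem lidClass_eq_one_of_forall_mem {f : C((Fin (m + 2) → I), X)} (hf : f ∈ LidCell A a m)
    (hfA : ∀ y, f y ∈ A) : lidClass f hf = 1 := by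
  have hall : ∀ y', cellCurry f hf y' ∈ inA A a := fun y' t => by rw [cellCurry_apply]; exact hfA _
  show toRel (CubeAbs.absClass pathContraction (cellCurry f hf) (fun y' _ => hall y')) = 1
  rw [CubeAbs.absClass_eq_one_of_forall_mem, map_one]

/-! ### Lidded cubes and the homotopy addition theorem -/

variable {M : ℕ}

variable (A a) in
/-- **Lidded cubes**: `g : Iᴹ⁺⁴ → X` with the lid `{y₀ = 1}` sent to `a`, the free face
`{y₀ = 0}` into `A`, and the points with two extreme coordinates among `y₁, …, y_{M+3}` into `A`
(so that all side faces `{yⱼ = ε}`, `j ≥ 1`, are lidded cells). [folklore] -/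
structure IsLidded (g : C((Fin (M + 4) → I), X)) : Prop where
  /-- the lid goes to the base point -/
  lid : ∀ y : Fin (M + 4) → I, y 0 = 1 → g y = a
  /-- the free face goes into `A` -/
  free : ∀ y : Fin (M + 4) → I, y 0 = 0 → g y ∈ A
  /-- the codimension-two strata of the side coordinates go into `A` -/
  skel : ∀ (y : Fin (M + 4) → I) (i j : Fin (M + 3)), i ≠ j → IsExtreme (y i.succ) →
    IsExtreme (y j.succ) → g y ∈ A

namespace IsLidded

variable {g : C((Fin (M + 4) → I), X)} (hg : IsLidded A a g)
include hg

/-- **The side faces `{y_{j+1} = ε}`, `ε = 0, 1`, of a lidded cube are lidded cells.** [folklore] -/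
lemma cubeFace_succ_mem (j : Fin (M + 3)) {ε : I} (hε : IsExtreme ε) :
    cubeFace g j.succ ε ∈ LidCell A a (M + 1) := by
  constructor
  · intro y hy
    rw [cubeFace_apply]
    refine hg.lid _ ?_
    rw [← Fin.succAbove_ne_zero_zero (Fin.succ_ne_zero j), Fin.insertNth_apply_succAbove]
    exact hy
  · rintro y ⟨i, hi⟩
    rw [cubeFace_apply]
    by_cases hi0 : i = 0
    · subst hi0
      rcases hi with hi | hi
      · refine hg.free _ ?_
        rw [← Fin.succAbove_ne_zero_zero (Fin.succ_ne_zero j), Fin.insertNth_apply_succAbove]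
        exact hi
      · rw [hg.lid _ ?_]
        · exact a.2
        rw [← Fin.succAbove_ne_zero_zero (Fin.succ_ne_zero j), Fin.insertNth_apply_succAbove]
        exact hi
    · -- a second extreme side coordinate
      obtain ⟨i', rfl⟩ := Fin.exists_succ_eq.2 hi0
      -- `j.succ.succAbove i'.succ = (j.succAbove i').succ`
      refine hg.skel _ j (j.succAbove i') (Fin.ne_succAbove j i') ?_ ?_
      · rw [Fin.insertNth_apply_same]; exact hε
      · rw [← Fin.succ_succAbove_succ, Fin.insertNth_apply_succAbove]; exact hi

/-- The path `t ↦ g (t, y')` over a point `y'` of the side coordinates. [folklore] -/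
lemma cons_zero_mem (y' : Fin (M + 3) → I) : g (Fin.cons 0 y') ∈ A := hg.free _ (by simp)

omit hg in
/-- The map `(y', t) ↦ g (t, y')`, jointly continuous. [folklore] -/
def pathFun (g : C((Fin (M + 4) → I), X)) : C((Fin (M + 3) → I) × I, X) where
  toFun q := g (Fin.cons q.2 q.1)
  continuous_toFun := g.continuous.comp continuous_consSwap

/-- **The curried lidded cube** `y' ↦ (t ↦ g (t, y'))`: a cube `Iᴹ⁺³ → P(X; A, a)`. [folklore] -/
def hat : C((Fin (M + 3) → I), EndPath A a) where
  toFun y' := ⟨(pathFun g).curry y', hg.cons_zero_mem y', hg.lid (Fin.cons 1 y') (Fin.cons_zero _ _)⟩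
  continuous_toFun := (pathFun g).curry.continuous.subtype_mk _

/-- The curried lidded cube pointwise. [folklore] -/
@[simp] lemma hat_apply (y' : Fin (M + 3) → I) (t : I) :
    ((hg.hat y' : EndPath A a) : C(I, X)) t = g (Fin.cons t y') := rfl

/-- The curried lidded cube maps the codimension-two skeleton into `P_A`. [folklore] -/
lemma isSkelIn_hat : CubeAbs.IsSkelIn (inA A a) hg.hat := by
  intro y' i j hij hi hj t
  rw [hat_apply]
  exact hg.skel _ i j hij (by simpa using hi) (by simpa using hj)

/-- The faces of the curried cube are the curried side faces. [folklore] -/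
lemma cubeFace_hat (j : Fin (M + 3)) {ε : I} (hε : IsExtreme ε) (y' : Fin (M + 2) → I) :
    cubeFace hg.hat j ε y' = cellCurry (cubeFace g j.succ ε) (hg.cubeFace_succ_mem j hε) y' := by
  apply Subtype.ext; apply ContinuousMap.ext; intro t
  rw [cubeFace_apply, hat_apply, cellCurry_apply, cubeFace_apply, Fin.insertNth_succ_cons]

/-- The classes of the side faces are the transported classes of the faces of the curried cube.
[folklore] -/
lemma lidClass_cubeFace_succ (j : Fin (M + 3)) {ε : I} (hε : IsExtreme ε) :
    lidClass (cubeFace g j.succ ε) (hg.cubeFace_succ_mem j hε) =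
      toRel (CubeAbs.absClass pathContraction (cubeFace hg.hat j ε) (hg.isSkelIn_hat.cubeFace_mem j hε)) := by
  show toRel _ = toRel _
  exact congrArg toRel (CubeAbs.absClass_congr pathContraction _ _ fun y' => (hg.cubeFace_hat j hε y').symm)

/-- **The homotopy addition theorem for a lidded cube**: the alternating product of the classes
of its side faces `{y_{j+1} = 1}`, `{y_{j+1} = 0}` (`j = 0, …, M + 2`) vanishes in the abelian
group `π_{M+3}(X, A, a)` — the cubical homotopy addition theorem (Hatcher 2002, §4.1
pp. 340–341) in the path space `P(X; A, a)`, applied to the curried cube after absolutising its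
codimension-two skeleton through the contractible `P_A`. [cite: HatcherAT2002, §4.1 pp. 340–341] -/
theorem prod_lidClass_cubeFace_zpow_eq_one :
    ∏ j : Fin (M + 3), (lidClass (cubeFace g j.succ 1) (hg.cubeFace_succ_mem j isExtreme_one) *
        (lidClass (cubeFace g j.succ 0) (hg.cubeFace_succ_mem j isExtreme_zero))⁻¹) ^
          ((-1 : ℤ) ^ (j : ℕ)) = 1 := by
  have key := congrArg (toRel (X := X) (A := A) (a := a))
    (CubeAbs.prod_absClass_cubeFace_zpow_eq_one pathContraction hg.hat hg.isSkelIn_hat)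
  rw [map_one, map_prod] at key
  rw [← key]
  refine Finset.prod_congr rfl fun j _ => ?_
  rw [map_zpow, map_mul, map_inv, ← hg.lidClass_cubeFace_succ j isExtreme_one,
    ← hg.lidClass_cubeFace_succ j isExtreme_zero]

end IsLidded

end LiddedCube

end Literature.AlgebraicTopology.Homotopy

end
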